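import Mathlib
import HarnessLib
import Summits.PneNP.PneNP.Theses.RamseyUncertifiable
import Literature.Combinatorics.SimpleGraph.RamseyNumbers

/-!
# Sketch — crux-ideate stmt-PneNP-9814 (`RamseyUncertifiable.RamseyNotNP` = X), round 1, ideator 1

First-lemma signatures (all elaborate; the glue theorems are PROVED, sorry-free) for two crux idea
cards on X = "RAMSEY₂ ∉ NP":

* Card `typical-one-sided-capture`: the counting vocabulary `countAt` / `total`, the one-sided
  typical-case capture hypothesis `TypicalCliqueCapture` (TCC), the quantitative Erdős statement
  `RamseyDense`, the PROVED capture `ramseyNotNP_of_typical : TCC → RamseyDense → X`, the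
  nondeterministic planted-clique refutation hypothesis `NondetPlantedRefutation ε` with the PROVED
  chain `typical_of_planted`, the clique-side shadow `CliqueSideNotNP` (Y) and the calibration
  statements `XImpliesY`, `CoNSubexpSqrt`, `FineGrainedFloor`.
* Card `preservation-vs-universality`: `IsRamseyFin`, the PROVED atom `not_isRamseyFin_top`
  (K_m is not 2-Ramsey for m ≥ 4), the combinatorial core `PointedNonHeredity` of the
  ∃*∀*-rung (PROVED: `pointedNonHeredity`, from the tree fact `ramsey_diagonal_le_four_pow_holds`), and the extreme rung `RamseyNPImmune` with the PROVED `ramseyNotNP_of_immune`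
  (stated for calibration; the card does NOT bet on it).
-/

namespace Summit.PneNP.PneNP.Cruxes.RamseyNotNP.Ideator1

open Literature.Computability.Complexity Finset
open Summit.PneNP.PneNP.Theses.RamseyUncertifiable (RamseyNotNP RamseyAbundant)

noncomputable section
open scoped Classical

/-! ## Common vocabulary -/

/-- Finite graphs `⟨n, G⟩` with vertex set `Fin n`, as coded by `encodingGraph` in the route file. -/
abbrev Gr : Type := Σ n, SimpleGraph (Fin n)

/-- The Erdős threshold `k(n) = ⌈2 log₂ n⌉ = Nat.clog 2 (n²)`. -/
def kk (n : ℕ) : ℕ := Nat.clog 2 (n ^ 2)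

/-- RAMSEY₂, literally the set inside `RamseyNotNP`. -/
def ramseySet : Set Gr :=
  {p | p.2.CliqueFree (Nat.clog 2 (p.1 ^ 2)) ∧ p.2ᶜ.CliqueFree (Nat.clog 2 (p.1 ^ 2))}

/-- The one-sided (clique) shadow: graphs with no clique of size `k(n)`. -/
def cliqueFreeSet : Set Gr := {p | p.2.CliqueFree (Nat.clog 2 (p.1 ^ 2))}

theorem ramseySet_subset_cliqueFreeSet : ramseySet ⊆ cliqueFreeSet := fun _ h => h.1

/-- `RamseyNotNP` is literally `toLanguage ramseySet ∉ NP`. -/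
theorem ramseyNotNP_iff : RamseyNotNP ↔ encodingGraph.toLanguage ramseySet ∉ Nondeterministic.NP :=
  Iff.rfl

/-- Number of labelled graphs on `Fin n` that lie in `S`. -/
def countAt (S : Set Gr) (n : ℕ) : ℕ :=
  (univ.filter fun G : SimpleGraph (Fin n) => (⟨n, G⟩ : Gr) ∈ S).card

/-- Number of all labelled graphs on `Fin n` (equal to `2 ^ (n.choose 2)`). -/
def total (n : ℕ) : ℕ := Fintype.card (SimpleGraph (Fin n))

theorem countAt_le_total (S : Set Gr) (n : ℕ) : countAt S n ≤ total n := by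
  unfold countAt total
  exact (card_filter_le _ _).trans (by simp)

/-! ## Card `typical-one-sided-capture` -/

/-- **TCC — typical one-sided capture.** Every NP language of graph codes all of whose members are
`k(n)`-clique-free misses a constant fraction of ALL `n`-vertex graphs for infinitely many `n`:
no NP property certifies `ω(G) < ⌈2 log₂ n⌉` for asymptotically all graphs. One-sided (cliques
only) and distributional (uniform measure); the `k = ⌈2log₂ n⌉` endpoint of the nondeterministic
planted-clique refutation hypothesis (`NondetPlantedRefutation`). -/
def TypicalCliqueCapture : Prop :=
  ∀ S : Set Gr, encodingGraph.toLanguage S ∈ Nondeterministic.NP → S ⊆ cliqueFreeSet →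
    ∃ c : ℝ, 0 < c ∧ ∀ n₀ : ℕ, ∃ n ≥ n₀, (countAt S n : ℝ) ≤ (1 - c) * total n

/-- **Quantitative Erdős 1947 at the exact threshold**: the proportion of `n`-vertex graphs that
are 2-Ramsey tends to `1` (union bound `2·C(n,k)·2^{-C(k,2)} ≤ 2^{1+k/2}/k! → 0`,
`k = ⌈2log₂ n⌉`). Provable now (M: a Finset double count). -/
def RamseyDense : Prop :=
  ∀ c : ℝ, 0 < c → ∃ n₀ : ℕ, ∀ n ≥ n₀, (1 - c) * (total n : ℝ) < countAt ramseySet n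

/-- **Capture (PROVED).** `TCC → RamseyDense → X`: a density-one language lies outside NP as soon
as NP cannot cover it up to density one, and covering RAMSEY₂ needs certifying the clique side. -/
theorem ramseyNotNP_of_typical (hT : TypicalCliqueCapture) (hD : RamseyDense) : RamseyNotNP := by
  intro hNP
  obtain ⟨c, hc, hio⟩ := hT ramseySet hNP ramseySet_subset_cliqueFreeSet
  obtain ⟨n₀, hn₀⟩ := hD c hc
  obtain ⟨n, hn, hle⟩ := hio n₀
  exact absurd (hn₀ n hn) (not_lt.mpr hle)

/-- Graphs with no clique of polynomial size `⌈n^{1/2-ε}⌉`. -/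
def polyCliqueFreeSet (ε : ℝ) : Set Gr := {p | p.2.CliqueFree ⌈(p.1 : ℝ) ^ (1 / 2 - ε)⌉₊}

/-- **nPCR(ε) — nondeterministic planted-clique refutation hypothesis** (the standard-shape
belief "nothing below √n is certifiable", in NP form): every NP language of graph codes whose
large members are all `⌈n^{1/2-ε}⌉`-clique-free misses a constant fraction of all graphs
infinitely often. Known for degree-`o(log n)` SoS verifiers (BHKKMP16, Thm 1.1). -/
def NondetPlantedRefutation (ε : ℝ) : Prop :=
  ∀ S : Set Gr, encodingGraph.toLanguage S ∈ Nondeterministic.NP →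
    (∃ N : ℕ, ∀ p ∈ S, N ≤ p.1 → p ∈ polyCliqueFreeSet ε) →
    ∃ c : ℝ, 0 < c ∧ ∀ n₀ : ℕ, ∃ n ≥ n₀, (countAt S n : ℝ) ≤ (1 - c) * total n

/-- Threshold comparison `⌈2log₂ n⌉ ≤ ⌈n^{1/2-ε}⌉` eventually (true for `ε < 1/2`; S). -/
def ThresholdBelowPoly (ε : ℝ) : Prop := ∃ N : ℕ, ∀ n ≥ N, kk n ≤ ⌈(n : ℝ) ^ (1 / 2 - ε)⌉₊

/-- **Chain (PROVED).** `nPCR(ε) → TCC` once the thresholds compare: certificates of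
`ω < ⌈2log₂n⌉` are certificates of `ω ≤ n^{1/2-ε}`. Hence `nPCR(ε) → RamseyDense → X`. -/
theorem typical_of_planted {ε : ℝ} (hth : ThresholdBelowPoly ε) (h : NondetPlantedRefutation ε) :
    TypicalCliqueCapture := by
  intro S hS hsub
  obtain ⟨N, hN⟩ := hth
  refine h S hS ⟨N, fun p hp hNp => ?_⟩
  exact (hsub hp).mono (hN p.1 hNp)

/-- **Y — the clique-side shadow of X**: `k(n)`-clique-freeness itself is not NP-certifiable. -/
def CliqueSideNotNP : Prop := encodingGraph.toLanguage cliqueFreeSet ∉ Nondeterministic.NP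

/-- `X → Y` (routine, S: `RAMSEY₂ = CF ∩ compl⁻¹(CF)`, NP is closed under `∩` and under the FP map
`code G ↦ code Gᶜ`; `preimage_mem_NP` in `NPClosureProofs`). Stated, not used by the capture. -/
def XImpliesY : Prop := RamseyNotNP → CliqueSideNotNP

/-- 3-UNSAT as a language of CNF codes (`encodingCNF`). -/
def threeUNSAT : Language Bool :=
  encodingCNF.toLanguage {φ : CNF ℕ | φ.IsWidthLE 3 ∧ ¬ φ.Satisfiable}

/-- **coN-ETH√** (a hypothesis strictly weaker than NETH for tautologies, Carmosino et al. 2016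
shape): 3-UNSAT has no nondeterministic refutations verifiable in time `2^{O(√N)}`. -/
def CoNSubexpSqrt : Prop := ∀ c : ℕ, threeUNSAT ∉ NTIME (fun N => 2 ^ (c * Nat.sqrt N + c))

/-- **Fine-grained floor (calibration, provable by padding).** Sparsification (IPZ) + 2-CSP blocks
of `√m` variables + multicoloured clique on `N = 2^{Θ(√m)}` vertices with `k = ⌈2log₂ N⌉` blocks:
an NP certificate for `k(N)`-clique-freeness refutes 3-CNFs in `NTIME(2^{O(√m)})`. So Y — the
necessary shadow of X — already follows from a fine-grained hypothesis; X's extra content is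
two-sidedness-or-typicality, and typicality (TCC) is the cheaper buy. -/
def FineGrainedFloor : Prop := CoNSubexpSqrt → CliqueSideNotNP

/-! ## Card `preservation-vs-universality` -/

/-- 2-Ramsey-ness of a graph on an arbitrary finite vertex type, at ITS OWN threshold. -/
def IsRamseyFin {V : Type*} [Fintype V] (H : SimpleGraph V) : Prop :=
  H.CliqueFree (Nat.clog 2 (Fintype.card V ^ 2)) ∧ Hᶜ.CliqueFree (Nat.clog 2 (Fintype.card V ^ 2))

theorem sq_le_two_pow : ∀ m : ℕ, 4 ≤ m → m ^ 2 ≤ 2 ^ m := by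
  intro m hm
  induction m, hm using Nat.le_induction with
  | base => norm_num
  | succ k hk ih =>
    have h2 : 2 * k + 1 ≤ k ^ 2 := by nlinarith [Nat.mul_le_mul_right k hk]
    calc (k + 1) ^ 2 = k ^ 2 + 2 * k + 1 := by ring
      _ ≤ k ^ 2 + k ^ 2 := by linarith [h2]
      _ ≤ 2 ^ k + 2 ^ k := by linarith [ih]
      _ = 2 ^ (k + 1) := by ring

/-- **Atom (PROVED): complete graphs on `m ≥ 4` vertices are not 2-Ramsey** (`⌈2log₂ m⌉ ≤ m`).
With its complement twin this is what every preservation argument lands on: a large 2-Ramsey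
graph contains `K_m` or its complement for `m ≥ ½ log₂ n` (Erdős–Szekeres). -/
theorem not_isRamseyFin_top {V : Type*} [Fintype V] (h4 : 4 ≤ Fintype.card V) :
    ¬ IsRamseyFin (⊤ : SimpleGraph V) := by
  intro h
  have hk : Nat.clog 2 (Fintype.card V ^ 2) ≤ Fintype.card V := by
    rw [Nat.clog_le_iff_le_pow (by norm_num)]
    exact sq_le_two_pow _ h4
  have hcl : (⊤ : SimpleGraph V).IsNClique (Fintype.card V) Finset.univ :=
    ⟨fun x _ y _ hxy => by simpa using hxy, Finset.card_univ⟩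
  exact (h.1.mono hk) _ hcl

/-- **Pointed non-heredity (combinatorial core of the ∃*∀* rung), PROVED below.** Any `a` marked
vertices `X` of any large graph lie inside a vertex set `Y` of BOUNDED size that contains a homogeneous
set of `G` of size `⌈2 log₂ |Y|⌉` — i.e. the induced subgraph `G[Y]` is not 2-Ramsey at its own size.
Consequence (card): no Σ¹₁(∃*∀*) sentence over `{E}` — and no certificate format whose acceptance is
preserved under "induced substructure containing the first-order witnesses" — has models of unbounded
size all of which are 2-Ramsey; in particular RAMSEY₂ is not definable there. -/
def PointedNonHeredity : Prop :=
  ∀ a : ℕ, ∃ n₁ b : ℕ, ∀ n ≥ n₁, ∀ G : SimpleGraph (Fin n), ∀ X : Finset (Fin n), X.card ≤ a →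
    ∃ Y : Finset (Fin n), X ⊆ Y ∧ Y.card ≤ b ∧ ∃ K ⊆ Y,
      G.IsNClique (Nat.clog 2 (Y.card ^ 2)) K ∨ Gᶜ.IsNClique (Nat.clog 2 (Y.card ^ 2)) K

theorem sq_le_two_pow_aux (a : ℕ) : (3 * a + 10) ^ 2 ≤ 2 ^ (2 * a + 10) := by
  induction a with
  | zero => norm_num
  | succ a ih =>
    have e1 : (3 * (a + 1) + 10) ^ 2 ≤ 4 * (3 * a + 10) ^ 2 :=
      Nat.le.intro (k := 27 * a ^ 2 + 162 * a + 231) (by ring)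
    calc (3 * (a + 1) + 10) ^ 2 ≤ 4 * (3 * a + 10) ^ 2 := e1
      _ ≤ 4 * 2 ^ (2 * a + 10) := by linarith [ih]
      _ = 2 ^ (2 * (a + 1) + 10) := by ring

/-- Complement commutes with pull-back along an embedding. -/
theorem compl_comap_eq' {α β : Type*} (G : SimpleGraph β) (f : α ↪ β) :
    (G.comap f)ᶜ = Gᶜ.comap f := by
  ext a b
  simp [SimpleGraph.compl_adj]

/-- Push an `m`-clique of `G.comap f` forward to an `m`-clique of `G`. -/
theorem isNClique_map_of_comap {α β : Type*} {G : SimpleGraph β} (f : α ↪ β) {m : ℕ}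
    {t : Finset α} (h : (G.comap f).IsNClique m t) : G.IsNClique m (t.map f) := by
  refine ⟨?_, by simp [h.card_eq]⟩
  intro x hx y hy hxy
  simp only [Finset.coe_map, Set.mem_image, Finset.mem_coe] at hx hy
  obtain ⟨a, ha, rfl⟩ := hx
  obtain ⟨b, hb, rfl⟩ := hy
  have hab : a ≠ b := fun e => hxy (by rw [e])
  exact h.isClique ha hb hab

/-- A homogeneous `m`-set in every graph on `n ≥ 4^m` vertices (Erdős–Szekeres via the tree fact
`ramsey_diagonal_le_four_pow_holds`; same transport as the disprover's `not_ramsey_of_fourPow_le`). -/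
theorem exists_homogeneous {n m : ℕ} (h : 4 ^ m ≤ n) (G : SimpleGraph (Fin n)) :
    ∃ T : Finset (Fin n), T.card = m ∧
      (G.IsClique (T : Set (Fin n)) ∨ Gᶜ.IsClique (T : Set (Fin n))) := by
  let f : Fin (4 ^ m) ↪ Fin n := Fin.castLEEmb h
  rcases Literature.Combinatorics.SimpleGraph.ramsey_diagonal_le_four_pow_holds m (G.comap f) with h1 | h2
  · simp only [SimpleGraph.CliqueFree, not_forall, not_not] at h1
    obtain ⟨t, ht⟩ := h1
    exact ⟨t.map f, (isNClique_map_of_comap f ht).card_eq, Or.inl (isNClique_map_of_comap f ht).isClique⟩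
  · rw [compl_comap_eq'] at h2
    simp only [SimpleGraph.CliqueFree, not_forall, not_not] at h2
    obtain ⟨t, ht⟩ := h2
    exact ⟨t.map f, (isNClique_map_of_comap f ht).card_eq, Or.inr (isNClique_map_of_comap f ht).isClique⟩

/-- **(PROVED)** pointed non-heredity of 2-Ramsey-ness. -/
theorem pointedNonHeredity : PointedNonHeredity := by
  intro a
  refine ⟨4 ^ (2 * a + 10), 3 * a + 10, fun n hn G X hX => ?_⟩
  obtain ⟨T, hTm, hT⟩ := exists_homogeneous hn G
  refine ⟨T ∪ X, Finset.subset_union_right, ?_, ?_⟩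
  · calc (T ∪ X).card ≤ T.card + X.card := Finset.card_union_le _ _
      _ ≤ (2 * a + 10) + a := Nat.add_le_add hTm.le hX
      _ = 3 * a + 10 := by ring
  · have hY : (T ∪ X).card ≤ 3 * a + 10 := by
      calc (T ∪ X).card ≤ T.card + X.card := Finset.card_union_le _ _
        _ ≤ (2 * a + 10) + a := Nat.add_le_add hTm.le hX
        _ = 3 * a + 10 := by ring
    have hr : Nat.clog 2 ((T ∪ X).card ^ 2) ≤ T.card := by
      rw [hTm]
      refine Nat.clog_le_of_le_pow ?_
      exact (Nat.pow_le_pow_left hY 2).trans (sq_le_two_pow_aux a)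
    obtain ⟨K, hKT, hKcard⟩ := Finset.exists_subset_card_eq hr
    refine ⟨K, hKT.trans Finset.subset_union_left, ?_⟩
    rcases hT with hc | hc
    · exact Or.inl ⟨hc.subset (Finset.coe_subset.mpr hKT), hKcard⟩
    · exact Or.inr ⟨hc.subset (Finset.coe_subset.mpr hKT), hKcard⟩

/-- An infinite family of graphs inside RAMSEY₂. -/
def InfiniteRamseyFamily (S : Set Gr) : Prop := S ⊆ ramseySet ∧ ∀ n₀ : ℕ, ∃ p ∈ S, n₀ ≤ p.1

/-- **X⁺ — NP-immunity of RAMSEY₂** (⇔ the Erdős planting map is a Krajíček proof complexity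
generator hard for ALL proof systems, Krajíček 2010 §30.4). The TOP of the preservation ladder and
STRICTLY riskier than X: it fails iff a nondeterministically explicit infinite family of 2-Ramsey
graphs exists. Stated for calibration; the card's line stops at X. -/
def RamseyNPImmune : Prop :=
  ∀ S : Set Gr, encodingGraph.toLanguage S ∈ Nondeterministic.NP → ¬ InfiniteRamseyFamily S

/-- **(PROVED)** `X⁺ → RamseyAbundant → X`. -/
theorem ramseyNotNP_of_immune (hI : RamseyNPImmune) (hA : RamseyAbundant) : RamseyNotNP := by
  intro hNP
  refine hI ramseySet hNP ⟨fun _ h => h, fun n₀ => ?_⟩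
  obtain ⟨G, hG⟩ := hA (max n₀ 3) (le_max_right _ _)
  exact ⟨⟨max n₀ 3, G⟩, hG, le_max_left _ _⟩

end

end Summit.PneNP.PneNP.Cruxes.RamseyNotNP.Ideator1
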